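import Summits.QuantumFields.YangMills.Theorems.FluctuationComparisonRegPrIntLS1aMemOfDominated
import Summits.QuantumFields.YangMills.Theorems.BackwardLiouvilleRigidityAdmFRFrameSoftPerturbation
import HarnessLib

/-!
# S1a · UV3-NODE §69.16 — THE (m)-DOOR OF RECORD FOR THE LINE'S TOWER, BOTH SIDES OF THE SWITCHING HEIGHT: ONE admissible schedule (slack enlarged by the dominance budget
# `Δ_j ≤ S₁q₁^j`) and, at EVERY height `j ≤ K` of EVERY cut-and-anchored tower of S1aᴴ, `∃ κ, MemOfRun F ℰp hjK {prm j with β := β_K} (e^κ·ρ j)` for the tower's continuous density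
# `ρ j`, from: the (α)-package + four binders + LF clause at `(K, K−j)` (✓p827768) + the cut-height letter `hdom_j` (✓p828170; at the uncut heights `ρᶜ = ρᵗ` and `hdom` is free)

Cell `ym3-torus` (YM ladder rung R3 = continuum `SU(2)` Yang–Mills on the three-torus — a RUNG: NOT d = 4, NOT infinite volume, NOT a mass gap, NOT Clay).
Width seat «width 8» `ym3-torus-px8` (gen 24), FREE px helper on crux `stmt-QuantumFields-20520`, count-neutral, DEFINITION-FREE, default heartbeats.  The composition of
✓p827768 `exists_admissible_schedule_memOfRun`, ✓p828170 `cutTower_le_run` ∕ `density_le_of_withDensity_le` ∕ `gaugeInvariant_of_continuous_of_ae` ∕ `mem_of_dominated` ∕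
`admissible_add_slack`, and ✓`…AdmFRFrameSoftPerturbation.gaugeInvariant_readAtLevel`; nothing of Bałaban's asserted.  Sorry-free, axioms standard.

WHAT.  ★★★ `exists_admissible_schedule_memOfRun_tower` — see the docstring.  HONEST: the (α)-inhabitant, the four binders, the LF clause, the letters `hdom_j` and the (R-β1′) β slot
remain displayed; S1a(ᴴ) (m) AS TYPED misstated by currency until (R-β1′) ∕ AS PRINTED OPEN; 20520 ∕ `YM3TorusSU2` NOT proved; rung R3 — NOT d = 4, NOT infinite volume, NOT a mass
gap, NOT Clay.
-/

set_option autoImplicit false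

noncomputable section

namespace Summit.QuantumFields.YangMills.Theorems.FluctuationComparisonRegPrIntLS1aAlphaMemOfRunTower

open MeasureTheory Set
open Literature.MathematicalPhysics.QuantumFieldTheory.Balaban1983to89
open T3ContinuumYM3Torus T3UnitScaleTilt T3UnitLawDensityEML T3RestrictedUnitDensity T3AlphaInputsAC T3AlphaInputsACSchemas T3AlphaInputsACTrivRows BalabanUVClass
open T3NestedUnitLaws (descend)
open Literature.MathematicalPhysics.QuantumFieldTheory.Balaban1983to89.Missing (partitionFn)
open Summit.QuantumFields.YangMills.Theorems.FluctuationComparisonRegPrIntLS1aAlphaMemOfRunOfAlpha (exists_admissible_schedule_memOfRun)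
open Summit.QuantumFields.YangMills.Theorems.FluctuationComparisonRegPrIntLS1aMemOfDominated
  (mem_of_dominated gaugeInvariant_of_continuous_of_ae density_le_of_withDensity_le cutTower_le_run admissible_add_slack)
open Summit.QuantumFields.YangMills.Theorems.AdmFRFrameSoftPerturbation (gaugeInvariant_readAtLevel)

variable {F : T3Family} {γ : ℝ}

/-- ★★★ **THE (m)-DOOR OF RECORD FOR THE TOWER.**  Under `AlphaInputsT3ACFullTriv …` and the numerics, and given a dominance budget `0 ≤ Δ_j ≤ S₁q₁^j` (`0 ≤ q₁ < 1`): there is ONE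
height schedule `prm` with `AdmissibleClassParams F γ (b₀∕2) p₀ prm` such that for EVERY run system `ν` of S1aᴴ, every `K`, `Ts ≤ K`, every tower `μ` agreeing with `ν K` from `Ts`
up and cut below by density weights `χ ≤ 1`, every height `j ≤ K`, and every pair of continuous densities `ρᶜ ≥ 0` of `μ j` (a.e. gauge invariant) and `ρᵗ ≥ 0` of `ν K j`:
the four binders + LF clause at `(K, K−j)` (window `θBal(b₀, j)`, LF exponent `(prm j).cLF`, for `Z_K·readAtLevel ρᵗ`) and the letter `hdom_j` («`ρᵗ ≤ e^{Δ_j}·ρᶜ` on the window,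
read on run `K`») give `∃ κ, MemOfRun F ℰp hjK {prm j with β := β_K} (fun V => Real.exp κ * ρᶜ V)`. [cite: Balaban1985UV3, (41)-(47) pp.266-267, (2) p.256, (6) p.257] -/
theorem exists_admissible_schedule_memOfRun_tower {D : AlphaDataT3 F γ} (W : LFData D) {b₀ p₀ ε₀ C68 Cχ B₃ r CD R₀ C₅ : ℝ} {M₁ : ℕ}
    (h : AlphaInputsT3ACFullTriv D W b₀ p₀ ε₀ C68 Cχ B₃ M₁ r CD) (hγ : 0 < γ) (hγ1 : γ ≤ 1) (hγe : Real.sqrt γ ≤ Real.exp (1 - p₀)) (hb : 0 ≤ b₀) (hp : 0 ≤ p₀)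
    (hr : 0 ≤ r) (hM1 : 1 ≤ M₁) (hMdvd : M₁ ∣ 2 * F.L ^ F.m) (hCD : 0 ≤ CD) (hR₀ : 0 < R₀)
    (Δ : ℕ → ℝ) {S₁ q₁ : ℝ} (hq₁0 : 0 ≤ q₁) (hq₁1 : q₁ < 1) (hΔ0 : ∀ j, 0 ≤ Δ j) (hΔ : ∀ j, Δ j ≤ S₁ * q₁ ^ j) :
    ∃ prm : ℕ → ClassParams, AdmissibleClassParams F γ (b₀ / 2) p₀ prm ∧
      (∀ n, (prm n).δ = θBal F.L γ b₀ p₀ n ∧ (prm n).δreg = R₀ ∧ (prm n).δL = θBal F.L γ b₀ p₀ n ∧ (prm n).β = (F.L : ℝ) ^ n / γ ∧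
        (prm n).cLF = B10.pFun (b₀ / 2) p₀ (Real.sqrt (γ * ((F.L : ℝ)⁻¹) ^ n)) ^ 2 / 4 ∧ (prm n).c5 = C₅ ∧ (prm n).cE = 0) ∧
      ∀ (ν : ℕ → (j : ℕ) → Measure (GaugeField (F.P j) 0 (Matrix.specialUnitaryGroup (Fin 2) ℂ))),
        (∀ K, ν K K = T4GenFunBounds.gibbsMeasure (F.P K) ((F.scheme ℰp γ).β K)) →
        (∀ K j, j < K → ν K j = Measure.map (descend F ℰp j) (ν K (j + 1))) →
        ∀ (K Ts : ℕ), Ts ≤ K → ∀ (μ : (j : ℕ) → Measure (GaugeField (F.P j) 0 (Matrix.specialUnitaryGroup (Fin 2) ℂ)))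
          (χ : (j : ℕ) → GaugeField (F.P j) 0 (Matrix.specialUnitaryGroup (Fin 2) ℂ) → ℝ), (∀ j U, χ j U ≤ 1) →
          (∀ j, Ts ≤ j → μ j = ν K j) →
          (∀ j, j < Ts → μ j = Measure.map (descend F ℰp j) ((μ (j + 1)).withDensity fun U => ENNReal.ofReal (χ (j + 1) U))) →
        ∀ (j : ℕ) (hjK : j ≤ K) (ρc ρt : GaugeField (F.P j) 0 (Matrix.specialUnitaryGroup (Fin 2) ℂ) → ℝ),
          Continuous ρc → Continuous ρt → (∀ V, 0 ≤ ρc V) → (∀ V, 0 ≤ ρt V) →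
          μ j = (fieldMeasure (F.P j) 0 (Matrix.specialUnitaryGroup (Fin 2) ℂ)).withDensity (fun V => ENNReal.ofReal (ρc V)) →
          ν K j = (fieldMeasure (F.P j) 0 (Matrix.specialUnitaryGroup (Fin 2) ℂ)).withDensity (fun V => ENNReal.ofReal (ρt V)) →
          (∀ g : Site (F.P j) 0 → Matrix.specialUnitaryGroup (Fin 2) ℂ,
            (fun V => ρc (GaugeField.gaugeAct g V)) =ᵐ[fieldMeasure (F.P j) 0 (Matrix.specialUnitaryGroup (Fin 2) ℂ)] ρc) →
          ContinuousOn (D.low K (K - j)) {V | PlaqSmall (θBal F.L γ b₀ p₀ j) V} →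
          ContinuousOn (D.up K (K - j)) {V | PlaqSmall (θBal F.L γ b₀ p₀ j) V} →
          (∀ V : GaugeField (F.P K) (K - j) (Matrix.specialUnitaryGroup (Fin 2) ℂ), PlaqSmall (θBal F.L γ b₀ p₀ j) V →
            IsBackground (fun i => BlockAveraging.blockAvg (P := F.P K) (j := i) ℰp) {U | PlaqSmall R₀ U} (K - j) V (D.Umin K (K - j) (D.triv K (K - j)) V)) →
          (∀ V : GaugeField (F.P K) (K - j) (Matrix.specialUnitaryGroup (Fin 2) ℂ),
            Real.exp (D.Ecst K (K - j)) * (Real.exp (-(D.Ecst K (K - j)) + D.Rm K (K - j)) * (D.up K (K - j) V - D.low K (K - j) V)) ≤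
              Real.exp (-(prm j).cLF) * Real.exp (C₅ * Fintype.card (Site (F.P K) (K - j)))) →
          (∀ (V : GaugeField (F.P K) (K - j) (Matrix.specialUnitaryGroup (Fin 2) ℂ)) (S : Finset (Plaq (F.P K) (K - j))),
            (∀ p ∈ S, θBal F.L γ b₀ p₀ j ≤ GaugeGroup.dist1 (GaugeField.plaqHol V p)) →
              Real.exp (D.Ecst K (K - j)) * (partitionFn (G := Matrix.specialUnitaryGroup (Fin 2) ℂ) (F.P K) ((F.scheme ℰp γ).β K) * readAtLevel F hjK ρt V) ≤
                Real.exp (-((prm j).cLF * S.card)) * Real.exp (C₅ * Fintype.card (Site (F.P K) (K - j)))) →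
          (∀ V : GaugeField (F.P K) (K - j) (Matrix.specialUnitaryGroup (Fin 2) ℂ), PlaqSmall (θBal F.L γ b₀ p₀ j) V →
            readAtLevel F hjK ρt V ≤ Real.exp (Δ j) * readAtLevel F hjK ρc V) →
          ∃ κ : ℝ, MemOfRun F ℰp hjK { prm j with β := (F.scheme ℰp γ).β K } (fun V => Real.exp κ * ρc V) := by
  obtain ⟨prm₀, hadm₀, hfields, hmem⟩ := exists_admissible_schedule_memOfRun (F := F) W h hγ hγ1 hγe hb hp hr hM1 hMdvd hCD hR₀
  refine ⟨fun n => { prm₀ n with slack := (prm₀ n).slack + Δ n }, admissible_add_slack F hadm₀ Δ hq₁0 hq₁1 hΔ,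
    fun n => ⟨(hfields n).1, (hfields n).2.1, (hfields n).2.2.1, (hfields n).2.2.2.1, (hfields n).2.2.2.2.1, (hfields n).2.2.2.2.2.1, (hfields n).2.2.2.2.2.2⟩, ?_⟩
  intro ν hν1 hν2 K Ts hTs μ χ hχ1 hμ1 hμ2 j hjK ρc ρt hcc htc hc0 ht0 hμc hνt hcinv hlowc hupc hRegClass hlfle hlarge hdom
  -- (m) for the run's density at this height
  obtain ⟨κ, hm⟩ := hmem ν hν1 hν2 K j hjK ρt htc ht0 hνt hlowc hupc hRegClass hlfle hlarge
  refine ⟨κ, ?_⟩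
  -- the cut density is dominated everywhere
  have hle : μ j ≤ ν K j := cutTower_le_run F ν hν2 hTs μ χ hχ1 hμ1 hμ2 j hjK
  rw [hμc, hνt] at hle
  have hptw : ∀ V, ρc V ≤ ρt V := density_le_of_withDensity_le hcc htc ht0 hle
  have hinv : GaugeField.GaugeInvariant ρc := gaugeInvariant_of_continuous_of_ae hcc hcinv
  -- transfer
  haveI : BorelSpace (GaugeField (F.P j) 0 (Matrix.specialUnitaryGroup (Fin 2) ℂ)) := T3OrbitAverage.instBorelSpaceGaugeField
  have hm' := mem_of_dominated (r' := readAtLevel F hjK (fun V => Real.exp κ * ρc V)) hm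
    (measurable_readAtLevel F hjK ((continuous_const.mul hcc).measurable))
    (gaugeInvariant_readAtLevel F hjK (fun u V => by show Real.exp κ * _ = Real.exp κ * _; rw [hinv u V]))
    (fun W => mul_nonneg (Real.exp_nonneg _) (hc0 _))
    (fun W => by rw [readAtLevel_apply, readAtLevel_apply]; exact mul_le_mul_of_nonneg_left (hptw _) (Real.exp_nonneg _))
    (hΔ0 j) (fun W hW => by
      rw [readAtLevel_apply, readAtLevel_apply]
      have hW' : PlaqSmall (θBal F.L γ b₀ p₀ j) W := by rw [← (hfields j).1]; exact hW
      have h1 := hdom W hW'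
      rw [readAtLevel_apply, readAtLevel_apply] at h1
      calc Real.exp κ * ρt _ ≤ Real.exp κ * (Real.exp (Δ j) * ρc _) := mul_le_mul_of_nonneg_left h1 (Real.exp_nonneg _)
        _ = Real.exp (Δ j) * (Real.exp κ * ρc _) := by ring)
  exact hm'

end Summit.QuantumFields.YangMills.Theorems.FluctuationComparisonRegPrIntLS1aAlphaMemOfRunTower

end
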